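import Mathlib
import HarnessLib
import Literature.Analysis.FluidPDE.TypeIAncientMildRescale
import Summits.NavierStokesRegularity.NavierStokesRegularity.Theorems.PoloidalWindowDoorLrcModEntireQ4CurvedFlatLimitEntrance
import Summits.NavierStokesRegularity.NavierStokesRegularity.Theorems.PoloidalWindowDoorLrcModEntireQ4CurvedSlopeWindow
import Summits.NavierStokesRegularity.NavierStokesRegularity.Theorems.PoloidalWindowDoorLrcModEntireQ4CurvedFlatCurtainWindow
import Summits.NavierStokesRegularity.NavierStokesRegularity.Theorems.SqueezeCycleExtremalElementExistsExtraction
import Summits.NavierStokesRegularity.NavierStokesRegularity.Theorems.PoloidalWindowDoorPoloidalWindowRigidityPoloidalExtremal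
import Summits.NavierStokesRegularity.NavierStokesRegularity.Theorems.PoloidalWindowDoorLrcModEntirePlanarCurveRigidity

/-!
# Route `PoloidalWindowDoor`, item `LrcModEntire` (stmt-NavierStokesRegularity-20428), cell (Q4-curved), VERTICAL child, ¬X_H residue
# `stub_Q4curvedAperiodicVerticalCurvedLimits` — LEMMA T: THE TRANSLATION-FLAT KILL

Cell ns-regularity-ideate, stub-worker seat ns-poloidal-K2-p2 g19 under the LEAD of item 20428 (ns-poloidal-K2-p3 g18); `--supports stmt-NavierStokesRegularity-20428
--as helper`.  Scoping line 2026-08-30T03:42:41Z (HOME STATUS.md).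

THE OBSERVATION.  The v17 literal X_H only looks at PARABOLIC blow-downs of the hull element `U` centred at the origin (time `−1` of `nsRescale λ U` is time
`−λ²` of `U`), so without the (paper) time-propagation of the curtain nothing is known there.  But the V-entrance (`…Q4CurvedVerticalEntrance.vertical_entrance`
(E1): the time `−1` slice of `U` is horizontally critical in its vertical component on the WHOLE cylinder `Γ × ℝ` over the base curve `Γ`) together with the
TRANSLATION invariance of the route's class gives a second compactness direction AT `t = −1`: translate along the base curve.  If the curvature of `Γ` flattens
along longer and longer arcs around the base points (literal `Y_T` below), every translation limit carries a FLAT vertical critical curtain through the origin and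
the H7 kill of the v17 chain (`…Q4CurvedSlopeWindow.slopeWindow_of_nonzero` (LEAD g18) + `…Q4CurvedFlatCurtainWindow.false_of_flatCurtain_slopeWindow`
(this seat)) ends it.  The honest complement ¬Y_T reads: the base curve is UNIFORMLY NON-FLAT (some `A, ε > 0`: every arc of length `2A` carries a point with
`‖Γ″‖ > ε`).

* `bilinearTH_translate` — the global (TH) bilinear identity passes to space translates (`curl` does by `…WeightSourceTranslate.curl_translate`);
* `apply_two_eq_of_tendsto_const` — bookkeeping: a pointwise limit of slices with a constant vertical component at one point keeps that value;
* `fderiv_apply_two_eq_zero_of_tendstoLocallyUniformly` — the MOVING-POINT limit of (E1): locally uniform convergence of the gradients + continuity of the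
  limit gradient + `xⱼ → x` + `∂_w(wⱼ)₂(xⱼ) = 0` ⇒ `∂_w W₂(x) = 0`;
* ★ `false_of_translation_limit_line` — class quintuple + hot value + (TH) bilinear identity + a planar base curve `Γ` through the hot level with (E1) + a
  sequence of base parameters `a n` and a horizontal unit `e` with `Γ(a n + s) − Γ(a n) → s•e` for every `s` ⊢ `False`
  (translate, extract with `…SqueezeCycleExtremalElementExistsExtraction.exists_tendsto_of_isTypeIAncientMild_seq`, pass poloidality / the bilinear
  identity / the hot value / the curtain to the limit, H7);
* `norm_sub_sub_smul_le_of_flat` — class-free curve estimate (T1): on an `ε`-flat arc of half-length `A`, `‖Γ(a+s) − Γ(a) − s•Γ′(a)‖ ≤ (ε·A)·|s|` (mean value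
  inequality twice); `apply_two_eq_zero_of_tendsto`; ★ `exists_flat_direction` — T1: under `Y_T` a subsequence of base points has `Γ(a n + s) − Γ(a n) → s•e` for a
  horizontal unit `e` (compactness of the unit sphere for the tangents `Γ′(a n)` + the estimate);
* ★★ `false_of_translationFlat_curtain` — LEMMA T: class quintuple + hot value + bilinear identity + `Γ` (C², planar, unit speed, on the hot level) + (E1) + `Y_T`
  ⊢ `False`.

WHAT THIS IS NOT: not a claim about Navier–Stokes regularity; a closable SUB-CASE (`Y_T`) of the research residue `stub_Q4curvedAperiodicVerticalCurvedLimits`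
(twist_split v17) — its complement ¬Y_T (uniformly non-flat base curve) stays research; items 20428 / 19708 / 27893 OPEN (bears_on LADDER-NS N0).
-/

noncomputable section

set_option linter.dupNamespace false
set_option linter.style.longLine false

namespace Summit.NavierStokesRegularity.NavierStokesRegularity.Theorems.PoloidalWindowDoorLrcModEntireQ4CurvedTranslationFlat

open Set Function Filter Topology Metric
open scoped RealInnerProductSpace InnerProductSpace ContDiff
open Literature.Analysis Literature.Analysis.FluidPDE Literature.Analysis.UnboundedOperators
open Summit.NavierStokesRegularity.NavierStokesRegularity.Theorems
open Summit.NavierStokesRegularity.NavierStokesRegularity.Theorems.PoloidalWindowDoorPoloidalWindowRigidityWindow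
open Summit.NavierStokesRegularity.NavierStokesRegularity.Theorems.PoloidalWindowDoorLrcModEntireQ4CurvedFlatLimitEntrance
open Summit.NavierStokesRegularity.NavierStokesRegularity.Theorems.PoloidalWindowDoorLrcModEntireQ4CurvedSlopeWindow
open Summit.NavierStokesRegularity.NavierStokesRegularity.Theorems.PoloidalWindowDoorLrcModEntireQ4CurvedFlatCurtainWindow
open Summit.NavierStokesRegularity.NavierStokesRegularity.Theorems.PoloidalWindowDoorPoloidalWindowRigidityPoloidalExtremal
open Summit.NavierStokesRegularity.NavierStokesRegularity.Theorems.PoloidalWindowDoorLrcModEntirePlanarCurveRigidity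

/-! ### A. Translation bookkeeping -/

/-- The global (TH) bilinear identity passes to the space translate `(t, x) ↦ U(t, x + a)`. -/
theorem bilinearTH_translate {U : ℝ → EuclideanSpace ℝ (Fin 3) → EuclideanSpace ℝ (Fin 3)}
    (hbil : ∀ t < 0, ∀ x x' : EuclideanSpace ℝ (Fin 3), x 2 = x' 2 → ∀ b c : Fin 3, b ≠ 2 → c ≠ 2 →
      fderiv ℝ (U t) x (EuclideanSpace.single 2 1) b * fderiv ℝ (U t) x' (EuclideanSpace.single c 1) 2 =
        fderiv ℝ (U t) x' (EuclideanSpace.single 2 1) c * fderiv ℝ (U t) x (EuclideanSpace.single b 1) 2)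
    (a : EuclideanSpace ℝ (Fin 3)) :
    ∀ t < 0, ∀ x x' : EuclideanSpace ℝ (Fin 3), x 2 = x' 2 → ∀ b c : Fin 3, b ≠ 2 → c ≠ 2 →
      fderiv ℝ ((fun t y => U t (y + a)) t) x (EuclideanSpace.single 2 1) b * fderiv ℝ ((fun t y => U t (y + a)) t) x' (EuclideanSpace.single c 1) 2 =
        fderiv ℝ ((fun t y => U t (y + a)) t) x' (EuclideanSpace.single 2 1) c * fderiv ℝ ((fun t y => U t (y + a)) t) x (EuclideanSpace.single b 1) 2 := by
  intro t ht x x' hxx' b c hb hc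
  have hxa : (x + a) 2 = (x' + a) 2 := by
    show x 2 + a 2 = x' 2 + a 2
    rw [hxx']
  show fderiv ℝ (fun y => U t (y + a)) x (EuclideanSpace.single 2 1) b * fderiv ℝ (fun y => U t (y + a)) x' (EuclideanSpace.single c 1) 2 =
    fderiv ℝ (fun y => U t (y + a)) x' (EuclideanSpace.single 2 1) c * fderiv ℝ (fun y => U t (y + a)) x (EuclideanSpace.single b 1) 2
  rw [fderiv_comp_add_right, fderiv_comp_add_right]
  exact hbil t ht (x + a) (x' + a) hxa b c hb hc

/-- Bookkeeping: if `wⱼ → W` pointwise at `x` and the vertical components `(wⱼ x)₂` are all equal to `N`, then `(W x)₂ = N`. -/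
theorem apply_two_eq_of_tendsto_const {F : ℕ → EuclideanSpace ℝ (Fin 3)} {L : EuclideanSpace ℝ (Fin 3)} {N : ℝ}
    (h : Tendsto F atTop (𝓝 L)) (hN : ∀ j, F j 2 = N) : L 2 = N := by
  have h2 : Tendsto (fun j => F j 2) atTop (𝓝 (L 2)) := ((EuclideanSpace.proj (𝕜 := ℝ) (2 : Fin 3)).continuous.tendsto _).comp h
  have hc : Tendsto (fun j => F j 2) atTop (𝓝 N) := by
    simp only [hN]; exact tendsto_const_nhds
  exact tendsto_nhds_unique h2 hc

/-- The coordinate form of the derivative of the vertical component: `∂_w(V₂)(x) = (DV(x) w)₂`. -/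
theorem fderiv_apply_two {V : EuclideanSpace ℝ (Fin 3) → EuclideanSpace ℝ (Fin 3)} {x : EuclideanSpace ℝ (Fin 3)} (hV : DifferentiableAt ℝ V x)
    (w : EuclideanSpace ℝ (Fin 3)) : fderiv ℝ (fun y => V y 2) x w = fderiv ℝ V x w 2 := by
  have hc := ((EuclideanSpace.proj (𝕜 := ℝ) (2 : Fin 3)).hasFDerivAt.comp x hV.hasFDerivAt).fderiv
  rw [show (fun y => V y 2) = (EuclideanSpace.proj (𝕜 := ℝ) (2 : Fin 3)) ∘ V from rfl, hc]
  rfl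

/-- **The moving-point limit of (E1).**  If the gradients `D(wⱼ)` converge locally uniformly to `DW`, `DW` is continuous at `x`, `xⱼ → x`, every `wⱼ` is
differentiable at `xⱼ`, `W` is differentiable at `x`, and `∂_w (wⱼ)₂ (xⱼ) = 0` for all `j`, then `∂_w W₂ (x) = 0`. -/
theorem fderiv_apply_two_eq_zero_of_tendstoLocallyUniformly {ws : ℕ → EuclideanSpace ℝ (Fin 3) → EuclideanSpace ℝ (Fin 3)}
    {W : EuclideanSpace ℝ (Fin 3) → EuclideanSpace ℝ (Fin 3)}
    (hlu : TendstoLocallyUniformly (fun j => fderiv ℝ (ws j)) (fderiv ℝ W) atTop)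
    {x : EuclideanSpace ℝ (Fin 3)} (hWc : ContinuousAt (fderiv ℝ W) x) (hWd : DifferentiableAt ℝ W x)
    {xs : ℕ → EuclideanSpace ℝ (Fin 3)} (hxs : Tendsto xs atTop (𝓝 x)) (hwd : ∀ j, DifferentiableAt ℝ (ws j) (xs j))
    {w : EuclideanSpace ℝ (Fin 3)} (hzero : ∀ j, fderiv ℝ (fun y => ws j y 2) (xs j) w = 0) :
    fderiv ℝ (fun y => W y 2) x w = 0 := by
  have hD : Tendsto (fun j => fderiv ℝ (ws j) (xs j)) atTop (𝓝 (fderiv ℝ W x)) := hlu.tendsto_comp hWc hxs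
  have hDw : Tendsto (fun j => fderiv ℝ (ws j) (xs j) w 2) atTop (𝓝 (fderiv ℝ W x w 2)) := by
    have h1 : Tendsto (fun j => fderiv ℝ (ws j) (xs j) w) atTop (𝓝 (fderiv ℝ W x w)) :=
      ((ContinuousLinearMap.apply ℝ (EuclideanSpace ℝ (Fin 3)) w).continuous.tendsto _).comp hD
    exact ((EuclideanSpace.proj (𝕜 := ℝ) (2 : Fin 3)).continuous.tendsto _).comp h1
  have hconst : (fun j => fderiv ℝ (ws j) (xs j) w 2) = fun _ => (0 : ℝ) := by
    funext j
    rw [← fderiv_apply_two (hwd j) w]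
    exact hzero j
  rw [hconst] at hDw
  have h0 : fderiv ℝ W x w 2 = 0 := (tendsto_nhds_unique hDw tendsto_const_nhds).symm ▸ rfl
  rw [fderiv_apply_two hWd w]
  exact h0

/-! ### B. The class-level kill from a translation limit along a flattening base curve -/

/-- ★ **A translation limit along base points where the curve straightens is contradictory.**  Hypotheses: the route's class quintuple for `U`, the hot value
`U₂(−1,0) ≠ 0`, the global (TH) bilinear identity, a planar base curve `Γ` lying on the hot level (`U₂(−1,Γ s) = U₂(−1,0)`) over which the slice `U(−1)` is
horizontally critical on the whole vertical cylinder ((E1) of `vertical_entrance`), and base parameters `a n` with `Γ(a n + s) − Γ(a n) → s•e` (`e` a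
horizontal unit vector) for every `s`.  Conclusion: `False`. -/
theorem false_of_translation_limit_line {C : ℝ} {U : ℝ → EuclideanSpace ℝ (Fin 3) → EuclideanSpace ℝ (Fin 3)}
    (hrate : HasTypeITimeDecay C U) (hcont : ContinuousOn (uncurry U) (Iio (0 : ℝ) ×ˢ univ))
    (hmild : ∀ s t : ℝ, s < t → t < 0 → ∀ x, U t x = heatExtension (U s) (t - s) x - oseenDuhamel 1 s U U t x)
    (hdiv : ∀ t < 0, VectorCalculus.IsDivFree (U t))
    (hpol : ∀ s < 0, ∀ q, ⟪curl (U s) q, EuclideanSpace.single 2 1⟫_ℝ = 0)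
    (hne : U (-1) 0 2 ≠ 0)
    (hbil : ∀ t < 0, ∀ x x' : EuclideanSpace ℝ (Fin 3), x 2 = x' 2 → ∀ b c : Fin 3, b ≠ 2 → c ≠ 2 →
      fderiv ℝ (U t) x (EuclideanSpace.single 2 1) b * fderiv ℝ (U t) x' (EuclideanSpace.single c 1) 2 =
        fderiv ℝ (U t) x' (EuclideanSpace.single 2 1) c * fderiv ℝ (U t) x (EuclideanSpace.single b 1) 2)
    {Γ : ℝ → EuclideanSpace ℝ (Fin 3)} (hhot : ∀ s, U (-1) (Γ s) 2 = U (-1) 0 2)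
    (hcurt : ∀ s z : ℝ, ∀ w : EuclideanSpace ℝ (Fin 3), w 2 = 0 →
      fderiv ℝ (fun y => U (-1) y 2) (Γ s + z • EuclideanSpace.single 2 (1 : ℝ)) w = 0)
    {a : ℕ → ℝ} {e : EuclideanSpace ℝ (Fin 3)} (he2 : e 2 = 0) (hun : ‖e‖ = 1)
    (hlim : ∀ s : ℝ, Tendsto (fun n => Γ (a n + s) - Γ (a n)) atTop (𝓝 (s • e))) : False := by
  have hs1 : (-1 : ℝ) < 0 := by norm_num
  -- H1: the class, and the translated sequence in the class
  have hA : IsTypeIAncientMild C U := isTypeIAncientMild_of_class hrate hcont hmild hdiv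
  set w : ℕ → ℝ → EuclideanSpace ℝ (Fin 3) → EuclideanSpace ℝ (Fin 3) := fun n t y => U t (y + Γ (a n)) with hw_def
  have hw : ∀ n, IsTypeIAncientMild C (w n) := fun n => hA.comp_add_right (Γ (a n))
  -- H3: class compactness with locally uniform convergence of slices and gradients
  obtain ⟨φ, hφ, W', hW', hpt, hfd, -, hfdlu⟩ := exists_tendsto_of_isTypeIAncientMild_seq C hw
  -- H4: the hot value survives at the origin
  have hval : W' (-1) 0 2 = U (-1) 0 2 := by
    refine apply_two_eq_of_tendsto_const (hpt (-1) hs1 0) fun j => ?_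
    show U (-1) (0 + Γ (a (φ j))) 2 = U (-1) 0 2
    rw [zero_add]; exact hhot _
  have hneW : ∃ t < 0, ∃ x, W' t x ≠ 0 := by
    refine ⟨-1, hs1, 0, fun h0 => hne ?_⟩
    rw [← hval, h0]; rfl
  -- H5: `W′` is poloidal and carries the (TH) bilinear identity
  have hpolW : ∀ s < 0, ∀ q, ⟪curl (W' s) q, EuclideanSpace.single 2 1⟫_ℝ = 0 := by
    intro s hs q
    refine poloidal_of_tendsto (V := fun j => w (φ j) s) (hfd s hs q) fun j => ?_
    show ⟪curl (fun y => U s (y + Γ (a (φ j)))) q, EuclideanSpace.single 2 1⟫_ℝ = 0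
    rw [PoloidalWindowDoorLrcModEntireWeightSourceTranslate.curl_translate]
    exact hpol s hs _
  have hbilW := bilinearTH_of_tendsto_fderiv (Ws := fun j => w (φ j)) (W := W') hfd fun j => bilinearTH_translate hbil (Γ (a (φ j)))
  -- H6: the limit curtain is the flat plane `{s•e + z•e₂}`
  have hW'd : Differentiable ℝ (W' (-1)) := (hW'.contDiff_slice hs1).differentiable (by simp)
  have hW'c : Continuous (fderiv ℝ (W' (-1))) := ((hW'.contDiff_slice hs1).continuous_fderiv (by simp))
  have hcurtW : ∀ s z : ℝ, ∀ v : EuclideanSpace ℝ (Fin 3), v 2 = 0 →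
      fderiv ℝ (fun y => W' (-1) y 2) ((0 : EuclideanSpace ℝ (Fin 3)) + s • e + z • EuclideanSpace.single 2 (1 : ℝ)) v = 0 := by
    intro s z v hv
    set xs : ℕ → EuclideanSpace ℝ (Fin 3) := fun j => (Γ (a (φ j) + s) - Γ (a (φ j))) + z • EuclideanSpace.single 2 (1 : ℝ) with hxs_def
    have hxs : Tendsto xs atTop (𝓝 ((0 : EuclideanSpace ℝ (Fin 3)) + s • e + z • EuclideanSpace.single 2 (1 : ℝ))) := by
      have h := ((hlim s).comp hφ.tendsto_atTop).add (tendsto_const_nhds (x := z • EuclideanSpace.single 2 (1 : ℝ)))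
      rw [zero_add]
      exact h
    refine fderiv_apply_two_eq_zero_of_tendstoLocallyUniformly (ws := fun j => w (φ j) (-1)) (hfdlu (-1) hs1) hW'c.continuousAt (hW'd _) hxs
      (fun j => ((hw (φ j)).contDiff_slice hs1).differentiable (by simp) _) fun j => ?_
    -- `∂_v (U₂(−1, · + Γ(a)))(xⱼ) = ∂_v U₂(−1) (Γ(a + s) + z e₂) = 0`
    have hcomp : fderiv ℝ (fun y : EuclideanSpace ℝ (Fin 3) => U (-1) (y + Γ (a (φ j))) 2) (xs j) =
        fderiv ℝ (fun y' : EuclideanSpace ℝ (Fin 3) => U (-1) y' 2) (xs j + Γ (a (φ j))) :=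
      fderiv_comp_add_right (f := fun y' : EuclideanSpace ℝ (Fin 3) => U (-1) y' 2) (Γ (a (φ j)))
    show fderiv ℝ (fun y => U (-1) (y + Γ (a (φ j))) 2) (xs j) v = 0
    have hpt' : xs j + Γ (a (φ j)) = Γ (a (φ j) + s) + z • EuclideanSpace.single 2 (1 : ℝ) := by
      show Γ (a (φ j) + s) - Γ (a (φ j)) + z • EuclideanSpace.single 2 (1 : ℝ) + Γ (a (φ j)) = _
      abel
    rw [hcomp, hpt']
    exact hcurt _ _ v hv
  -- H7: a class profile with a flat vertical critical curtain is trivial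
  have he : e ≠ 0 := by
    intro h; rw [h, norm_zero] at hun; exact zero_ne_one hun
  obtain ⟨c₀, η, hη, μ, hμ, hslope⟩ := slopeWindow_of_nonzero hW'.hasTypeITimeDecay hW'.continuousOn_uncurry
    (fun s t hst ht x => hW'.mild_eq_heatExtension hst ht x) (fun t ht => hW'.isDivFree ht) hpolW hbilW hneW
  exact false_of_flatCurtain_slopeWindow hW'.hasTypeITimeDecay hW'.continuousOn_uncurry (fun s t hst ht x => hW'.mild_eq_heatExtension hst ht x)
    (fun t ht => hW'.isDivFree ht) hpolW hη hμ hslope he2 he hcurtW hneW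

/-! ### C. Class-free curve geometry (T1): a flattening sequence of arcs has a straight translation limit -/

section Curve

variable {Γ : ℝ → EuclideanSpace ℝ (Fin 3)}

/-- **Second-order flatness estimate.**  If `‖Γ″(a + σ)‖ ≤ ε` for `|σ| ≤ A`, then `‖Γ(a+s) − Γ(a) − s•Γ′(a)‖ ≤ (ε·A)·|s|` for `|s| ≤ A`
(the mean value inequality on the convex set `[−A, A]`, applied to `σ ↦ Γ′(a+σ) − Γ′(a)` and then to `σ ↦ Γ(a+σ) − Γ(a) − σ•Γ′(a)`). -/
theorem norm_sub_sub_smul_le_of_flat (hΓ : ContDiff ℝ 2 Γ) {a A ε : ℝ} (hA : 0 ≤ A) (hε : 0 ≤ ε)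
    (hflat : ∀ σ : ℝ, |σ| ≤ A → ‖deriv (deriv Γ) (a + σ)‖ ≤ ε) {s : ℝ} (hs : |s| ≤ A) :
    ‖Γ (a + s) - Γ a - s • deriv Γ a‖ ≤ ε * A * |s| := by
  have hI : Convex ℝ (Icc (-A) A) := convex_Icc _ _
  have h0 : (0 : ℝ) ∈ Icc (-A) A := ⟨by linarith, hA⟩
  have hmem : ∀ {σ : ℝ}, |σ| ≤ A → σ ∈ Icc (-A) A := fun h => ⟨by linarith [(abs_le.1 h).1], (abs_le.1 h).2⟩
  -- first integration: `‖Γ′(a+σ) − Γ′(a)‖ ≤ ε·|σ| ≤ ε·A`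
  set g : ℝ → EuclideanSpace ℝ (Fin 3) := fun σ => deriv Γ (a + σ) - deriv Γ a with hg_def
  have hg : ∀ σ : ℝ, HasDerivAt g (deriv (deriv Γ) (a + σ)) σ := fun σ =>
    ((hasDerivAt_of_contDiff_two hΓ (a + σ)).2.comp_const_add a σ).sub_const _
  have hg_bound : ∀ σ ∈ Icc (-A) A, ‖g σ‖ ≤ ε * A := by
    intro σ hσ
    have hσA : |σ| ≤ A := abs_le.2 ⟨hσ.1, hσ.2⟩
    have h := hI.norm_image_sub_le_of_norm_hasDerivWithin_le (f := g) (f' := fun σ => deriv (deriv Γ) (a + σ))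
      (fun x _ => (hg x).hasDerivWithinAt) (fun x hx => hflat x (abs_le.2 ⟨hx.1, hx.2⟩)) h0 hσ
    have hg0 : g 0 = 0 := by simp [hg_def]
    rw [hg0, sub_zero, sub_zero] at h
    calc ‖g σ‖ ≤ ε * ‖σ‖ := h
      _ = ε * |σ| := by rw [Real.norm_eq_abs]
      _ ≤ ε * A := mul_le_mul_of_nonneg_left hσA hε
  -- second integration
  set h : ℝ → EuclideanSpace ℝ (Fin 3) := fun σ => Γ (a + σ) - Γ a - σ • deriv Γ a with hh_def
  have hh : ∀ σ : ℝ, HasDerivAt h (g σ) σ := by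
    intro σ
    have h1 : HasDerivAt (fun σ : ℝ => Γ (a + σ)) (deriv Γ (a + σ)) σ := (hasDerivAt_of_contDiff_two hΓ (a + σ)).1.comp_const_add a σ
    have h2 : HasDerivAt (fun σ : ℝ => σ • deriv Γ a) (deriv Γ a) σ := by
      simpa using (hasDerivAt_id σ).smul_const (deriv Γ a)
    have h3 := (h1.sub_const (Γ a)).sub h2
    exact h3
  have hmain := hI.norm_image_sub_le_of_norm_hasDerivWithin_le (f := h) (f' := g) (fun x _ => (hh x).hasDerivWithinAt) hg_bound h0 (hmem hs)
  have hh0 : h 0 = 0 := by simp [hh_def]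
  rw [hh0, sub_zero, sub_zero, Real.norm_eq_abs] at hmain
  exact hmain

/-- A limit of vectors with vanishing `e₂`-coordinate has vanishing `e₂`-coordinate. -/
theorem apply_two_eq_zero_of_tendsto {F : ℕ → EuclideanSpace ℝ (Fin 3)} {L : EuclideanSpace ℝ (Fin 3)}
    (h : Tendsto F atTop (𝓝 L)) (h0 : ∀ j, F j 2 = 0) : L 2 = 0 := by
  have h2 : Tendsto (fun j => F j 2) atTop (𝓝 (L 2)) := ((EuclideanSpace.proj (𝕜 := ℝ) (2 : Fin 3)).continuous.tendsto _).comp h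
  have hc : Tendsto (fun j => F j 2) atTop (𝓝 0) := by
    simp only [h0]; exact tendsto_const_nhds
  exact tendsto_nhds_unique h2 hc

/-- ★ **T1 — a flattening sequence of arcs has a straight translation limit.**  See the module docstring. -/
theorem exists_flat_direction (hΓ : ContDiff ℝ 2 Γ) (hΓ2 : ∀ s, Γ s 2 = 0) (hunit : ∀ s, ‖deriv Γ s‖ = 1) {a : ℕ → ℝ}
    (hflat : ∀ A ε : ℝ, 0 < ε → ∀ᶠ n in atTop, ∀ s : ℝ, |s| ≤ A → ‖deriv (deriv Γ) (a n + s)‖ ≤ ε) :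
    ∃ φ : ℕ → ℕ, StrictMono φ ∧ ∃ e : EuclideanSpace ℝ (Fin 3), e 2 = 0 ∧ ‖e‖ = 1 ∧
      ∀ s : ℝ, Tendsto (fun j => Γ (a (φ j) + s) - Γ (a (φ j))) atTop (𝓝 (s • e)) := by
  -- compactness of the unit sphere: a subsequence of the unit tangents `Γ′(a n)` converges
  have hsph : ∀ n, deriv Γ (a n) ∈ sphere (0 : EuclideanSpace ℝ (Fin 3)) 1 := fun n => by
    rw [mem_sphere_zero_iff_norm]; exact hunit _
  obtain ⟨e, he, φ, hφ, hconv⟩ := (isCompact_sphere (0 : EuclideanSpace ℝ (Fin 3)) 1).tendsto_subseq hsph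
  have hconv' : Tendsto (fun j => deriv Γ (a (φ j))) atTop (𝓝 e) := hconv
  refine ⟨φ, hφ, e, ?_, mem_sphere_zero_iff_norm.1 he, fun s => ?_⟩
  · exact apply_two_eq_zero_of_tendsto hconv' fun j => (deriv_horizontal hΓ hΓ2 _).1
  -- the second-order estimate makes `Γ(a+s) − Γ(a) − s•Γ′(a) → 0` along the flattening arcs
  have hrem : Tendsto (fun j => Γ (a (φ j) + s) - Γ (a (φ j)) - s • deriv Γ (a (φ j))) atTop (𝓝 0) := by
    rw [Metric.tendsto_nhds]
    intro ε hε
    set A : ℝ := |s| + 1 with hA_def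
    have hA : 0 < A := by positivity
    have hsA : |s| ≤ A := by linarith [abs_nonneg s]
    have hε' : 0 < ε / (2 * A * A) := by positivity
    have hev := (hφ.tendsto_atTop).eventually (hflat A (ε / (2 * A * A)) hε')
    filter_upwards [hev] with j hj
    rw [dist_zero_right]
    have hle := norm_sub_sub_smul_le_of_flat hΓ hA.le hε'.le hj hsA
    calc ‖Γ (a (φ j) + s) - Γ (a (φ j)) - s • deriv Γ (a (φ j))‖ ≤ ε / (2 * A * A) * A * |s| := hle
      _ ≤ ε / (2 * A * A) * A * A := mul_le_mul_of_nonneg_left hsA (by positivity)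
      _ = ε / 2 := by field_simp
      _ < ε := by linarith
  have hsum := hrem.add (hconv'.const_smul s)
  simp only [zero_add, sub_add_cancel] at hsum
  exact hsum

end Curve

/-! ### D. LEMMA T -/

/-- ★★ **LEMMA T — THE TRANSLATION-FLAT KILL.**  A profile of the route's class (Type-I decay, continuity, Oseen-mild, divergence-free, poloidal) with hot value
`U₂(−1,0) ≠ 0` and the global (TH) bilinear identity, carrying a `C²` planar unit-speed base curve `Γ` on the hot level over which the time `−1` slice is
horizontally critical in its vertical component on the whole vertical cylinder ((E1) of `…Q4CurvedVerticalEntrance.vertical_entrance`), CANNOT have arcs of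
flattening curvature around a sequence of base points (literal `Y_T`).  Proof: `exists_flat_direction` + `false_of_translation_limit_line`. -/
theorem false_of_translationFlat_curtain {C : ℝ} {U : ℝ → EuclideanSpace ℝ (Fin 3) → EuclideanSpace ℝ (Fin 3)}
    (hrate : HasTypeITimeDecay C U) (hcont : ContinuousOn (uncurry U) (Iio (0 : ℝ) ×ˢ univ))
    (hmild : ∀ s t : ℝ, s < t → t < 0 → ∀ x, U t x = heatExtension (U s) (t - s) x - oseenDuhamel 1 s U U t x)
    (hdiv : ∀ t < 0, VectorCalculus.IsDivFree (U t))
    (hpol : ∀ s < 0, ∀ q, ⟪curl (U s) q, EuclideanSpace.single 2 1⟫_ℝ = 0)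
    (hne : U (-1) 0 2 ≠ 0)
    (hbil : ∀ t < 0, ∀ x x' : EuclideanSpace ℝ (Fin 3), x 2 = x' 2 → ∀ b c : Fin 3, b ≠ 2 → c ≠ 2 →
      fderiv ℝ (U t) x (EuclideanSpace.single 2 1) b * fderiv ℝ (U t) x' (EuclideanSpace.single c 1) 2 =
        fderiv ℝ (U t) x' (EuclideanSpace.single 2 1) c * fderiv ℝ (U t) x (EuclideanSpace.single b 1) 2)
    {Γ : ℝ → EuclideanSpace ℝ (Fin 3)} (hΓ : ContDiff ℝ 2 Γ) (hΓ2 : ∀ s, Γ s 2 = 0) (hunit : ∀ s, ‖deriv Γ s‖ = 1)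
    (hhot : ∀ s, U (-1) (Γ s) 2 = U (-1) 0 2)
    (hcurt : ∀ s z : ℝ, ∀ w : EuclideanSpace ℝ (Fin 3), w 2 = 0 →
      fderiv ℝ (fun y => U (-1) y 2) (Γ s + z • EuclideanSpace.single 2 (1 : ℝ)) w = 0)
    (hflat : ∃ a : ℕ → ℝ, ∀ A ε : ℝ, 0 < ε → ∀ᶠ n in atTop, ∀ s : ℝ, |s| ≤ A → ‖deriv (deriv Γ) (a n + s)‖ ≤ ε) : False := by
  obtain ⟨a, ha⟩ := hflat
  obtain ⟨φ, -, e, he2, hun, hlim⟩ := exists_flat_direction hΓ hΓ2 hunit ha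
  exact false_of_translation_limit_line hrate hcont hmild hdiv hpol hne hbil hhot hcurt (a := fun j => a (φ j)) he2 hun hlim

end Summit.NavierStokesRegularity.NavierStokesRegularity.Theorems.PoloidalWindowDoorLrcModEntireQ4CurvedTranslationFlat

end
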